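import Summits.CriticalPhenomena.PercolationContinuityZ3.Theorems.Transplant.SkelPhiParaCorridorKGY
import Summits.CriticalPhenomena.PercolationContinuityZ3.Theorems.Transplant.SkelPhiParaCorridorKGRead
import HarnessLib

/-!
# N2 (frames-only node `SamePDropOfSkeletonFrm₁`, OPEN), LEVEL 1, (C) column: THE RUN-FRAME READINGS OF THE y′-RUN PHASE OF THE SECOND-AXIS K-G
# CORRIDOR — the widened y′-run `yRunPrmB` rendered on axis `oth 0` of the x-run frame `runX φ c₀ n h σ` (origin `0`): membership in the enlarged
# core / region / core (along = coordinate `1`, across = coordinate `0`), LINK (`pgramPrism ↦ region`) and LANDING of the steered TOP piece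
# (`pgTopPieceW … σ τₖ v ↦ core (k+1)`).  Phases 2 and 3 of `kgCorrSchedY` are read by `xParkSchedC` / `yParkSchedC` (SkelPhiParaCorridorKGRead p342358).
builds on p205010 (kernel theorem, internal audit signed; external expert review pending) — nothing in this file uses p205010; nothing here is a
claim about the open node `SamePDropOfSkeletonFrm₁`.
Lane `prim-bschramm`, seat `prim-bschramm-p5` (gen 15; (C) lineage); helper file (`--supports stmt-CriticalPhenomena-4575`).
* `yRunSchedB`, `mem_yRunB_enl/region/core_iff`, **`yRunB_mem_region_of_link`**, **`yRunB_mem_core_succ_of_piece`**.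
[cite: KozmaNitzan2024, §4 Lemma 11 (pp. 22–23)] [cite: MartineauTassion2017, §3.2 Lemma 3.5, §4.3 Lemma 4.2 (arXiv:1312.1946 pp. 12–14)]
-/

noncomputable section

namespace Summit.CriticalPhenomena.PercolationContinuityZ3.Theorems.Transplant

namespace Skelφ

open Literature.Probability.Percolation Literature.Probability.LatticeModels SimpleGraph
open Literature.Probability.Percolation.KozmaNitzan.Cells (oth)
open ChainPlanar ChainPara

variable {V : Type} {G : SimpleGraph V} {φ : V → Site 2}

/-- `oth 1 = 0`. [folklore] -/
private theorem oth_one'' : oth (1 : Fin 2) = 0 := by decide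

section RunYB

variable {n ℓ : ℕ} {h v : ℤ} (hn : 1 ≤ n) (hv : |v| ≤ n) (hlay : (n + h.natAbs : ℕ) ≤ (n : ℤ) * ℓ + 1) (R' q W N : ℕ)

/-- The widened y′-run schedule rendered on axis `oth 0` of the x-run frame (sign `1`, origin `0`). [this work] -/
abbrev yRunSchedB : ScheduleN :=
  (yRunPrmB n ℓ h v R' q W N).scheduleN (oth 0) (σ := 1) (Or.inl rfl) 0 (yRunPrmB_ok hn hv hlay R' q W N) (yRunPrmB_eb n ℓ h v R' q W N)

/-- Membership in the `R′`-enlarged core `k`: along = coordinate `1`, across = coordinate `0`. [folklore] -/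
theorem mem_yRunB_enl_iff {k : ℕ} {y : Site 2} :
    y ∈ Finset.Icc ((yRunSchedB hn hv hlay R' q W N).lo k - (((yRunSchedB hn hv hlay R' q W N).R' : ℕ) : Site 2))
        ((yRunSchedB hn hv hlay R' q W N).hi k + (((yRunSchedB hn hv hlay R' q W N).R' : ℕ) : Site 2)) ↔
      (yRunPrmB n ℓ h v R' q W N).InEnl k (y 1) (y 0) := by
  show y ∈ Finset.Icc (dLo (oth 0) 1 0 _ _ _ _ - (((yRunPrmB n ℓ h v R' q W N).ea : ℕ) : Site 2))
      (dHi (oth 0) 1 0 _ _ _ _ + (((yRunPrmB n ℓ h v R' q W N).ea : ℕ) : Site 2)) ↔ _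
  rw [dBox_enlarge (Or.inl rfl), RunPrm.mem_enlarge_iff (Or.inl rfl) (yRunPrmB_eb n ℓ h v R' q W N)]
  simp [oth_zero, oth_one'']

/-- Membership in region `k`. [folklore] -/
theorem mem_yRunB_region_iff {k : ℕ} {y : Site 2} :
    y ∈ (yRunSchedB hn hv hlay R' q W N).region k ↔ (yRunPrmB n ℓ h v R' q W N).InRegion k (y 1) (y 0) := by
  show y ∈ (yRunPrmB n ℓ h v R' q W N).pregion (oth 0) 1 0 k ↔ _
  rw [RunPrm.mem_pregion_iff (Or.inl rfl)]; simp [oth_zero, oth_one'']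

/-- Membership in core `k`. [folklore] -/
theorem mem_yRunB_core_iff {k : ℕ} {y : Site 2} :
    y ∈ (yRunSchedB hn hv hlay R' q W N).core k ↔ (yRunPrmB n ℓ h v R' q W N).InCore k (y 1) (y 0) := by
  rw [RunPrm.scheduleN_core, RunPrm.mem_pcore_iff (Or.inl rfl)]; simp [oth_zero, oth_one'']

/-- **LINK (y′-run phase)**: `runX t` in the enlarged core `k` and `w ∈ pgramPrism t n h (3ℓ) R` give `runX w ∈ region k`. [cite: KozmaNitzan2024, §4 Lemma 11 (p. 22)] -/
theorem yRunB_mem_region_of_link (c₀ : V) {σ : ℤ} (hσ : σ = 1 ∨ σ = -1) {k : ℕ} {t w : V} {R : ℕ}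
    (ht : runX φ c₀ n h σ t ∈ Finset.Icc ((yRunSchedB hn hv hlay R' q W N).lo k - (((yRunSchedB hn hv hlay R' q W N).R' : ℕ) : Site 2))
      ((yRunSchedB hn hv hlay R' q W N).hi k + (((yRunSchedB hn hv hlay R' q W N).R' : ℕ) : Site 2)))
    (hw : w ∈ pgramPrism G φ t n h (3 * ℓ) R) : runX φ c₀ n h σ w ∈ (yRunSchedB hn hv hlay R' q W N).region k := by
  have ht' := (mem_yRunB_enl_iff hn hv hlay R' q W N).1 ht
  obtain ⟨h0, h1⟩ := link_runX hn c₀ h hσ hw R' 0 0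
  refine (mem_yRunB_region_iff hn hv hlay R' q W N).2 (RunPrm.inRegion_of_link ht' ?_ ?_)
  · simpa [xPrmW, yRunPrmB, yPrmW] using h1
  · simpa [xPrmW, yRunPrmB, yPrmW] using h0

/-- **LANDING (y′-run phase)**: with `τₖ := steer k (runX t 0)` of the widened y′-run, every `w ∈ pgTopPieceW t n h ℓ R σ τₖ v` has `runX w ∈ core (k+1)`.
[cite: MartineauTassion2017, §4.3 Lemma 4.2] [cite: KozmaNitzan2024, §4 Lemma 11 (pp. 22–23)] -/
theorem yRunB_mem_core_succ_of_piece [G.LocallyFinite] (c₀ : V) {σ : ℤ} (hσ : σ = 1 ∨ σ = -1) {k : ℕ} {t w : V} {R : ℕ}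
    (ht : runX φ c₀ n h σ t ∈ Finset.Icc ((yRunSchedB hn hv hlay R' q W N).lo k - (((yRunSchedB hn hv hlay R' q W N).R' : ℕ) : Site 2))
      ((yRunSchedB hn hv hlay R' q W N).hi k + (((yRunSchedB hn hv hlay R' q W N).R' : ℕ) : Site 2)))
    (hw : w ∈ pgTopPieceW G φ t n h ℓ R σ ((yRunPrmB n ℓ h v R' q W N).steer k (runX φ c₀ n h σ t 0)) v) :
    runX φ c₀ n h σ w ∈ (yRunSchedB hn hv hlay R' q W N).core (k + 1) := by
  set P := yRunPrmB n ℓ h v R' q W N with hPdef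
  set τ₀ := P.steer k (runX φ c₀ n h σ t 0) with hτ₀
  have hτ₀' : τ₀ = 1 ∨ τ₀ = -1 := P.steer_eq_or k _
  have ht' := (mem_yRunB_enl_iff hn hv hlay R' q W N).1 ht
  obtain ⟨⟨hlo, hhi⟩, hpc⟩ := landing_runY_W hn c₀ h hσ hτ₀' hw R' q N
  rw [runY_zero, runY_zero, ← runX_one φ c₀ n h σ w, ← runX_one φ c₀ n h σ t] at hlo hhi
  rw [runY_one, runY_one, ← runX_zero φ c₀ n h σ w, ← runX_zero φ c₀ n h σ t] at hpc
  have hpiece : P.InPiece τ₀ (runX φ c₀ n h σ w 0 - runX φ c₀ n h σ t 0 - P.d) := by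
    simpa [RunPrm.InPiece, yPrmW, yRunPrmB, hPdef] using hpc
  refine (mem_yRunB_core_iff hn hv hlay R' q W N).2 (RunPrm.inCore_succ_of_landing (yRunPrmB_ok hn hv hlay R' q W N) ht' ?_ ?_ hpiece)
  · simpa [yPrmW, yRunPrmB, hPdef] using hlo
  · simpa [yPrmW, yRunPrmB, hPdef] using hhi

end RunYB

end Skelφ

end Summit.CriticalPhenomena.PercolationContinuityZ3.Theorems.Transplant

end
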